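import Summits.KontsevichZagierPeriods.KontsevichZagierPeriods.Theses.K2SymbolChains
import Summits.KontsevichZagierPeriods.KontsevichZagierPeriods.Theorems.K2SymbolChainsJensenIsScissorsCases
import Summits.KontsevichZagierPeriods.KontsevichZagierPeriods.Theorems.K2SymbolChainsJensenIsScissorsRotation
import Literature.NumberTheory.Transcendental.KZSemialgebraicComplex
import Literature.NumberTheory.Transcendental.SemialgebraicMapsSmoothProofs

/-!
# Jensen is a move (and is scissors) — proof of the crux `JensenMove` (stmt-KontsevichZagierPeriods-5199)
# and of the support item `JensenIsScissors` (stmt-KontsevichZagierPeriods-5204)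

Route KontsevichZagierPeriods/K2SymbolChains, item `JensenMove` ("JENSEN IS A MOVE": over any
`ℚ`-semialgebraic base `τ ⊆ ℝⁿ` with semialgebraic weight `h` and centre `α = α₁ + iα₂`, the
unfolded torus representation `r` of `∫_τ h · J(α)`, `J(α) = ∫₀^{2π} log|e^{iφ} − α| dφ`, and the
unfolded representation `r′` of `∫_τ h · 2π log⁺|α|` satisfy `[r] − [r′] ∈ KZ.relations`).

Written by the crux-strategist (planner) of the route re-audit as the glued split of the crux into
three pieces, each of which turned out to be provable from the tree. Everything is proved for an
arbitrary subgroup `S ⊇ (1a) ∪ (1b) ∪ (2)` of `KZ.FormalRep` (`…_mem` theorems), so that the case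
`S = KZ.relations` is the crux `JensenMove` and the case `S = closure ((1a) ∪ (1b) ∪ (2))` is the
sharper support item `JensenIsScissors` (no Newton–Leibniz move is used anywhere):

* `jensenMoveDisc` — the move over bases where `α` is differentiable and `0 < |α| ≤ 1`
  (`[r] ∈ relations`): coordinate bridge to the signed unfolding `KZ.logUnfoldDomain`, the landed
  `rotation_step` (`W_α → W_ρ`, `ρ = |α|`, rule 2), base cut `{|α| < 1} ∪ {|α| = 1}` (rule 1a) and
  the landed `jensen_inside` (doubling + radial constancy) / `jensen_circle` (doubling alone) of
  `Theorems/K2SymbolChainsJensenIsScissorsCases.lean`;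
* `jensenMoveOutside` — the move where `α` is differentiable and `|α| > 1`: rotation, the `log⁺`
  representation in normal form, and the landed `jensen_outside` (signed product rule
  `W_ρ = ρ² W_{1/ρ}` + Jensen inside for `1/ρ`);
* `genericDifferentiability` — a `ℚ`-semialgebraic function on a `ℚ`-semialgebraic `τ` is
  differentiable on a `ℚ`-semialgebraic `B ⊆ τ` of full measure (interior + the tree's
  piecewise-smoothness theorem `IsSemialgebraicFunOn.exists_contDiffOn_holds`, BCR §2.9, and
  `KZ.volume_eq_zero_of_interior_eq_empty`);
* `jensenMove_mem` / `jensenMove : K2SymbolChains.JensenMove` / `jensenIsScissors :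
  K2SymbolChains.JensenIsScissors` — the glue: intersect the smooth loci of `α₁, α₂`,
  discard the null remainder and the locus `α = 0` (empty fibre, `|e(s)|² = 1`), cut the base into
  the two regimes (rule 1a), and note that `r′` lives over the exterior regime up to a null set
  (the same glue, with the pieces as hypotheses, is `JensenMove_of_subs` of the strategist's split
  file `Cruxes/JensenMove/Lines/split_disc_outside_generic.lean`).

The three piece statements are spelled out verbatim as filed on the route, and the last section
restates them over the route's declarations: `jensenMoveDisc_item` (stmt-KontsevichZagierPeriods-17759
`JensenMoveDisc`), `jensenMoveOutside_item` (17758 `JensenMoveOutside`), `genericDifferentiability_item`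
(17757 `GenericDifferentiability`) and the glue `jensenMoveGlue_item` (17791 `JensenMoveGlue`). [Jensen 1899; Kontsevich–Zagier 2001, §1.2, rules 1)–2); Bochnak–Coste–Roy 1998, §§2.2, 2.8, 2.9]
[folklore]
-/

noncomputable section

open MeasureTheory Set
open Literature.NumberTheory.Transcendental Literature.ModelTheory.ExponentialFields

namespace Summit.KontsevichZagierPeriods.K2SymbolChains.JensenMoveProof

open Literature.NumberTheory.Transcendental.KZ
open Summit.KontsevichZagierPeriods.K2SymbolChains.JensenIsScissorsProof

variable {n : ℕ}

/-- The three scissors move sets lie in `KZ.relations`. [Kontsevich–Zagier 2001, §1.2] [folklore] -/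
theorem scissors_subset_relations :
    domainAddRel ∪ integrandAddRel ∪ changeOfVariablesRel ⊆ (relations : AddSubgroup FormalRep) := by
  rintro c ((hc | hc) | hc)
  · exact domainAddRel_subset_relations hc
  · exact integrandAddRel_subset_relations hc
  · exact changeOfVariablesRel_subset_relations hc

/-- Cylinders `{(x, s, u) | x ∈ P}` over `ℚ`-semialgebraic subsets `P` of the base `ℝⁿ` are
`ℚ`-semialgebraic (an iterated `init`-cylinder). [folklore] -/
theorem isSemialgebraic_cyl2 {P : Set (Fin n → ℝ)} (hP : IsSemialgebraic ℚ P) :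
    IsSemialgebraic ℚ {w : Fin (n + 2) → ℝ | (fun i : Fin n => w (Fin.castAdd 2 i)) ∈ P} := by
  have h := isSemialgebraic_cyl (isSemialgebraic_cyl hP)
  exact h

/-- Cylinders over null subsets of the base are null. [folklore] -/
theorem volume_cyl2_eq_zero {P : Set (Fin n → ℝ)} (hP : volume P = 0) :
    volume {w : Fin (n + 2) → ℝ | (fun i : Fin n => w (Fin.castAdd 2 i)) ∈ P} = 0 := by
  have h := volume_setOf_init_mem_eq_zero (volume_setOf_init_mem_eq_zero hP)
  exact h

/-- `|e(s) − 0|² = 1` for the rational point `e(s) = ((1 − s²) + 2is)/(1 + s²)` of the circle.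
[folklore] -/
theorem ratCircle_normSq (s : ℝ) :
    ((1 - s ^ 2) / (1 + s ^ 2) - 0) ^ 2 + (2 * s / (1 + s ^ 2) - 0) ^ 2 = 1 := by
  have hs : (1 + s ^ 2) ≠ 0 := by positivity
  field_simp
  ring

/-- **A weight lemma**: if `F` is integrable on a measurable `B` and `m` is measurable with
`|m| ≤ C`, then `m · F` is integrable on `B`. [folklore] -/
theorem integrableOn_measurable_bdd_mul {n : ℕ} {B : Set (Fin n → ℝ)} {F m : (Fin n → ℝ) → ℝ}
    (hF : IntegrableOn F B) (hm : Measurable m) {C : ℝ} (hC : ∀ x, |m x| ≤ C) :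
    IntegrableOn (fun x => m x * F x) B :=
  Integrable.bdd_mul hF hm.aestronglyMeasurable (Filter.Eventually.of_forall fun x => by
    simpa [Real.norm_eq_abs] using hC x)

/-- **Rotation to the real-centre normal form**: the item's domain and integrand are
the signed unfolding over `{b | init b ∈ B}` of `h/(1+s²) · log W_α` (coordinate bridge, `rfl` up to
`(h/(1+s²))/u = h/((1+s²)u)`), and the landed `rotation_step` carries `W_α` to `W_ρ`.
[Kontsevich–Zagier 2001, §1.2, rule 2)] [folklore] -/
theorem rotate_normal_form {S : AddSubgroup Literature.NumberTheory.Transcendental.KZ.FormalRep} (hS : Literature.NumberTheory.Transcendental.KZ.domainAddRel ∪ Literature.NumberTheory.Transcendental.KZ.integrandAddRel ∪ Literature.NumberTheory.Transcendental.KZ.changeOfVariablesRel ⊆ S) : ∀ (n : ℕ) (B : Set (Fin n → ℝ)) (h α₁ α₂ : (Fin n → ℝ) → ℝ) (r : Literature.NumberTheory.Transcendental.KZ.IntegralRep (n + 2)), Literature.ModelTheory.ExponentialFields.IsSemialgebraic ℚ B → Literature.NumberTheory.Transcendental.IsSemialgebraicFunOn ℚ B h → Literature.NumberTheory.Transcendental.IsSemialgebraicFunOn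 ℚ B α₁ → Literature.NumberTheory.Transcendental.IsSemialgebraicFunOn ℚ B α₂ → (∀ x ∈ B, DifferentiableAt ℝ α₁ x ∧ DifferentiableAt ℝ α₂ x) → (∀ x ∈ B, α₁ x ^ 2 + α₂ x ^ 2 ≠ 0) → r.domain = {w | (fun i : Fin n => w (Fin.castAdd 2 i)) ∈ B ∧ ((1 < w (Fin.natAdd n 1) ∧ w (Fin.natAdd n 1) < (((1 - w (Fin.natAdd n 0) ^ 2) / (1 + w (Fin.natAdd n 0) ^ 2) - α₁ (fun i : Fin n => w (Fin.castAdd 2 i))) ^ 2 + (2 * w (Fin.natAdd n 0) / (1 + w (Fin.natAdd n 0) ^ 2) - α₂ (fun i : Fin n => w (Fin.castAdd 2 i))) ^ 2)) ∨ ((((1 - w (Fin.natAdd n 0) ^ 2) / (1 + w (Fin.natAdd n 0) ^ 2) - α₁ (fun i : Fin n => w (Fin.castAdd 2 i))) ^ 2 + (2 * w (Fin.natAdd n 0) / (1 + w (Fin.natAdd n 0) ^ 2) - α₂ (fun i : Fin n => w (Fin.castAdd 2 i))) ^ 2) < w (Fin.natAdd n 1) ∧ w (Fin.natAdd n 1)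 < 1))} → (∀ w ∈ r.domain, r.integrand w = (if 1 < w (Fin.natAdd n 1) then (1:ℝ) else -1) * h (fun i : Fin n => w (Fin.castAdd 2 i)) / ((1 + w (Fin.natAdd n 0) ^ 2) * w (Fin.natAdd n 1))) → ∃ R' : Literature.NumberTheory.Transcendental.KZ.IntegralRep (n + 1 + 1), R'.domain = Literature.NumberTheory.Transcendental.KZ.logUnfoldDomain {b : Fin (n + 1) → ℝ | Fin.init b ∈ B} (fun b => ((1 - Real.sqrt (α₁ (Fin.init b) ^ 2 + α₂ (Fin.init b) ^ 2)) ^ 2 + (1 + Real.sqrt (α₁ (Fin.init b) ^ 2 + α₂ (Fin.init b) ^ 2)) ^ 2 * b (Fin.last n) ^ 2) / (1 + b (Fin.last n) ^ 2)) ∧ R'.integrand = Literature.NumberTheory.Transcendental.KZ.logUnfoldIntegrand (fun b => h (Fin.init b) / (1 + b (Fin.last n) ^ 2)) ∧ Literature.NumberTheory.Transcendental.KZ.of r - Literature.NumberTheory.Transcendental.KZ.of R' ∈ S := by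
  intro n B h α₁ α₂ r hB hh hα₁ hα₂ hdiff hne hrd hri
  have hrd' : r.domain = logUnfoldDomain {b : Fin (n + 1) → ℝ | Fin.init b ∈ B}
      (fun b => ((1 - b (Fin.last n) ^ 2) / (1 + b (Fin.last n) ^ 2) - α₁ (Fin.init b)) ^ 2 +
        (2 * b (Fin.last n) / (1 + b (Fin.last n) ^ 2) - α₂ (Fin.init b)) ^ 2) := by
    rw [hrd]; rfl
  have hri' : EqOn r.integrand
      (logUnfoldIntegrand fun b => h (Fin.init b) / (1 + b (Fin.last n) ^ 2)) r.domain := by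
    intro w hw
    rw [hri w hw]
    show (if 1 < w (Fin.natAdd n 1) then (1:ℝ) else -1) * h (fun i : Fin n => w (Fin.castAdd 2 i)) /
        ((1 + w (Fin.natAdd n 0) ^ 2) * w (Fin.natAdd n 1)) =
      (if 1 < w (Fin.natAdd n 1) then (1:ℝ) else -1) *
        (h (fun i : Fin n => w (Fin.castAdd 2 i)) / (1 + w (Fin.natAdd n 0) ^ 2)) / w (Fin.natAdd n 1)
    rw [mul_div_assoc, mul_div_assoc, div_div]
  exact rotation_step hS hB hh hα₁ hα₂ hne (fun x hx => (hdiff x hx).1) (fun x hx => (hdiff x hx).2) r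
    hrd' hri'

/-- **Weights**: `h = F · (1 + |log|α|²|)⁻¹` and
`h · log ρ = F · (log|α|²/2)(1 + |log|α|²|)⁻¹` with `F = h(1 + |log|α|²|) ∈ L¹(B)` and bounded
measurable multipliers (Tarski–Seidenberg measurability of semialgebraic functions). [folklore] -/
theorem weights : ∀ (n : ℕ) (B : Set (Fin n → ℝ)) (h α₁ α₂ : (Fin n → ℝ) → ℝ), Literature.ModelTheory.ExponentialFields.IsSemialgebraic ℚ B → Literature.NumberTheory.Transcendental.IsSemialgebraicFunOn ℚ B h → Literature.NumberTheory.Transcendental.IsSemialgebraicFunOn ℚ B α₁ → Literature.NumberTheory.Transcendental.IsSemialgebraicFunOn ℚ B α₂ → MeasureTheory.IntegrableOn (fun x => h x * (1 + |Real.log (α₁ x ^ 2 + α₂ x ^ 2)|)) B → MeasureTheory.IntegrableOn h B ∧ MeasureTheory.IntegrableOn (fun x => h x * Real.log (Real.sqrt (α₁ x ^ 2 + α₂ x ^ 2))) B := by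
  intro n B h α₁ α₂ hB hh hα₁ hα₂ hint
  have hBm : MeasurableSet B := IsSemialgebraic.measurableSet_holds hB
  set ρ2 : (Fin n → ℝ) → ℝ := fun x => α₁ x ^ 2 + α₂ x ^ 2 with hρ2_def
  have hρ2 : IsSemialgebraicFunOn ℚ B ρ2 :=
    (IsSemialgebraicFunOn.add_holds (IsSemialgebraicFunOn.mul_holds hα₁ hα₁)
      (IsSemialgebraicFunOn.mul_holds hα₂ hα₂)).congr fun x _ => by
      simp only [hρ2_def, Pi.add_apply, Pi.mul_apply]; ring
  have hρ2_nonneg : ∀ x, 0 ≤ ρ2 x := fun x => by simp only [hρ2_def]; positivity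
  -- a measurable version of `ρ2` agreeing with it on `B`
  set V : (Fin n → ℝ) → ℝ := B.indicator ρ2 with hV_def
  have hVm : Measurable V := hρ2.measurable_indicator_of_tarskiSeidenberg tarski_seidenberg_real_holds hBm
  have hVB : ∀ x ∈ B, V x = ρ2 x := fun x hx => by simp [hV_def, indicator_of_mem hx]
  have hL : Measurable fun x => Real.log (V x) := Real.measurable_log.comp hVm
  -- the two bounded multipliers
  set m₁ : (Fin n → ℝ) → ℝ := fun x => (1 + |Real.log (V x)|)⁻¹ with hm₁_def
  set m₂ : (Fin n → ℝ) → ℝ := fun x => Real.log (V x) / 2 * (1 + |Real.log (V x)|)⁻¹ with hm₂_def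
  have hm₁ : Measurable m₁ := (measurable_const.add hL.abs).inv
  have hm₂ : Measurable m₂ := (hL.div_const 2).mul (measurable_const.add hL.abs).inv
  have hpos : ∀ x, 0 < 1 + |Real.log (V x)| := fun x => by positivity
  have hb₁ : ∀ x, |m₁ x| ≤ 1 := fun x => by
    have h1 : 1 ≤ 1 + |Real.log (V x)| := by linarith [abs_nonneg (Real.log (V x))]
    rw [hm₁_def, abs_inv, abs_of_pos (hpos x)]
    exact inv_le_one_of_one_le₀ h1
  have hb₂ : ∀ x, |m₂ x| ≤ 1 := fun x => by
    have ha := abs_nonneg (Real.log (V x))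
    show |Real.log (V x) / 2 * (1 + |Real.log (V x)|)⁻¹| ≤ 1
    rw [abs_mul, abs_inv, abs_of_pos (hpos x), abs_div, abs_two, ← div_eq_mul_inv,
      div_le_one (hpos x)]
    linarith
  have e₁ := integrableOn_measurable_bdd_mul hint hm₁ hb₁
  have e₂ := integrableOn_measurable_bdd_mul hint hm₂ hb₂
  constructor
  · refine e₁.congr_fun (fun x hx => ?_) hBm
    have hne : (1 + |Real.log (α₁ x ^ 2 + α₂ x ^ 2)| : ℝ) ≠ 0 := by positivity
    simp only [hm₁_def, hVB x hx, hρ2_def]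
    field_simp
  · refine e₂.congr_fun (fun x hx => ?_) hBm
    have hne : (1 + |Real.log (α₁ x ^ 2 + α₂ x ^ 2)| : ℝ) ≠ 0 := by positivity
    have h0 : 0 ≤ α₁ x ^ 2 + α₂ x ^ 2 := by positivity
    simp only [hm₂_def, hVB x hx, hρ2_def]
    rw [Real.log_sqrt h0]
    field_simp

/-- **Jensen on the punctured closed disc, smooth centre** (the statement of route item
`K2SymbolChains.JensenMoveDisc`, spelled out). [Jensen 1899; Kontsevich–Zagier 2001, §1.2] [folklore] -/
theorem jensenMoveDisc_mem {S : AddSubgroup Literature.NumberTheory.Transcendental.KZ.FormalRep} (hS : Literature.NumberTheory.Transcendental.KZ.domainAddRel ∪ Literature.NumberTheory.Transcendental.KZ.integrandAddRel ∪ Literature.NumberTheory.Transcendental.KZ.changeOfVariablesRel ⊆ S) :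
    ∀ (n : ℕ) (τ : Set (Fin n → ℝ)) (h α₁ α₂ : (Fin n → ℝ) → ℝ) (r : Literature.NumberTheory.Transcendental.KZ.IntegralRep (n + 2)), Literature.ModelTheory.ExponentialFields.IsSemialgebraic ℚ τ → Literature.NumberTheory.Transcendental.IsSemialgebraicFunOn ℚ τ h → Literature.NumberTheory.Transcendental.IsSemialgebraicFunOn ℚ τ α₁ → Literature.NumberTheory.Transcendental.IsSemialgebraicFunOn ℚ τ α₂ → (∀ x ∈ τ, DifferentiableAt ℝ α₁ x ∧ DifferentiableAt ℝ α₂ x) → (∀ x ∈ τ, 0 < α₁ x ^ 2 + α₂ x ^ 2 ∧ α₁ x ^ 2 + α₂ x ^ 2 ≤ 1) → MeasureTheory.IntegrableOn (fun x => h x * (1 + |Real.log (α₁ x ^ 2 + α₂ x ^ 2)|)) τ → r.domain = {w | (fun i : Fin n => w (Fin.castAdd 2 i)) ∈ τ ∧ ((1 < w (Fin.natAdd n 1) ∧ w (Fin.natAdd n 1) < (((1 - w (Fin.natAdd n 0) ^ 2) / (1 + w (Fin.natAdd n 0) ^ 2) - α₁ (fun i : Fin n => w (Fin.castAdd 2 i)))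 ^ 2 + (2 * w (Fin.natAdd n 0) / (1 + w (Fin.natAdd n 0) ^ 2) - α₂ (fun i : Fin n => w (Fin.castAdd 2 i))) ^ 2)) ∨ ((((1 - w (Fin.natAdd n 0) ^ 2) / (1 + w (Fin.natAdd n 0) ^ 2) - α₁ (fun i : Fin n => w (Fin.castAdd 2 i))) ^ 2 + (2 * w (Fin.natAdd n 0) / (1 + w (Fin.natAdd n 0) ^ 2) - α₂ (fun i : Fin n => w (Fin.castAdd 2 i))) ^ 2) < w (Fin.natAdd n 1) ∧ w (Fin.natAdd n 1) < 1))} → (∀ w ∈ r.domain, r.integrand w = (if 1 < w (Fin.natAdd n 1) then (1:ℝ) else -1) * h (fun i : Fin n => w (Fin.castAdd 2 i)) / ((1 + w (Fin.natAdd n 0) ^ 2) * w (Fin.natAdd n 1))) → Literature.NumberTheory.Transcendental.KZ.of r ∈ S := by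
  have hrot := rotate_normal_form hS
  have hw := @weights
  intro n τ h α₁ α₂ r hτ hh hα₁ hα₂ hdiff hreg hint hrd hri
  -- the regimes `|α| < 1` (`Tl`) and `|α| = 1` (`Te`)
  set ρ2 : (Fin n → ℝ) → ℝ := fun x => α₁ x ^ 2 + α₂ x ^ 2 with hρ2_def
  have hρ2 : IsSemialgebraicFunOn ℚ τ ρ2 :=
    (IsSemialgebraicFunOn.add_holds (IsSemialgebraicFunOn.mul_holds hα₁ hα₁)
      (IsSemialgebraicFunOn.mul_holds hα₂ hα₂)).congr fun x _ => by
      simp only [hρ2_def, Pi.add_apply, Pi.mul_apply]; ring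
  set g : (Fin n → ℝ) → ℝ := fun x => ρ2 x - 1 with hg_def
  have hg : IsSemialgebraicFunOn ℚ τ g :=
    (IsSemialgebraicFunOn.sub_holds hρ2 (isSemialgebraicFunOn_ratCast hτ 1)).congr fun x _ => by
      simp [hg_def]
  set Tl : Set (Fin n → ℝ) := {x | x ∈ τ ∧ g x < 0} with hTl_def
  set Te : Set (Fin n → ℝ) := {x | x ∈ τ ∧ g x = 0} with hTe_def
  have hTl : IsSemialgebraic ℚ Tl := hg.isSemialgebraic_sep_neg
  have hTe : IsSemialgebraic ℚ Te := hg.isSemialgebraic_sep_eq_zero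
  have hTlτ : Tl ⊆ τ := fun x hx => hx.1
  have hTeτ : Te ⊆ τ := fun x hx => hx.1
  -- the modulus
  set ρ : (Fin n → ℝ) → ℝ := fun x => Real.sqrt (α₁ x ^ 2 + α₂ x ^ 2) with hρ_def
  have hρs : ∀ {B : Set (Fin n → ℝ)}, B ⊆ τ → IsSemialgebraic ℚ B → IsSemialgebraicFunOn ℚ B ρ :=
    fun hB hBs => isSemialgebraicFunOn_modulus (hα₁.mono hB hBs) (hα₂.mono hB hBs)
  have hρd : ∀ x ∈ τ, DifferentiableAt ℝ ρ x := fun x hx =>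
    differentiableAt_modulus (hdiff x hx).1 (hdiff x hx).2 (hreg x hx).1.ne'
  have hρ0 : ∀ x ∈ τ, 0 < ρ x := fun x hx => Real.sqrt_pos.2 (hreg x hx).1
  have hρ_lt : ∀ x ∈ Tl, ρ x < 1 := fun x hx => by
    have h1 : ρ2 x < 1 := by have := hx.2; simp only [hg_def] at this; linarith
    have := Real.sqrt_lt_sqrt (hreg x hx.1).1.le h1
    simpa [hρ_def, hρ2_def] using this
  have hρ_eq : ∀ x ∈ Te, ρ x = 1 := fun x hx => by
    have h1 : ρ2 x = 1 := by have := hx.2; simp only [hg_def] at this; linarith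
    simp only [hρ_def]
    simp only [hρ2_def] at h1
    rw [h1, Real.sqrt_one]
  -- cylinders and the cut of `r`
  set Cl : Set (Fin (n + 2) → ℝ) := {w | (fun i : Fin n => w (Fin.castAdd 2 i)) ∈ Tl} with hCl_def
  set Ce : Set (Fin (n + 2) → ℝ) := {w | (fun i : Fin n => w (Fin.castAdd 2 i)) ∈ Te} with hCe_def
  have hCl : IsSemialgebraic ℚ Cl := isSemialgebraic_cyl2 hTl
  have hCe : IsSemialgebraic ℚ Ce := isSemialgebraic_cyl2 hTe
  set rl := r.restrict (r.domain ∩ Cl) (r.isSemialgebraic_domain.inter hCl) inter_subset_left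
    with hrl_def
  set r₁ := r.restrict (r.domain \ Cl) (r.isSemialgebraic_domain.diff hCl) sdiff_subset with hr₁_def
  have e1 : of r - of rl - of r₁ ∈ S := of_sub_restrict_inter_sub_restrict_diff_mem hS r hCl
  set re := r₁.restrict (r₁.domain ∩ Ce) (r₁.isSemialgebraic_domain.inter hCe) inter_subset_left
    with hre_def
  set r₂ := r₁.restrict (r₁.domain \ Ce) (r₁.isSemialgebraic_domain.diff hCe) sdiff_subset with hr₂_def
  have e2 : of r₁ - of re - of r₂ ∈ S := of_sub_restrict_inter_sub_restrict_diff_mem hS r₁ hCe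
  -- the remainder is empty (regime hypothesis)
  have e3 : of r₂ ∈ S := by
    refine of_mem_of_volume_eq_zero hS r₂ (measure_mono_null (fun w hw => ?_) (measure_empty (α := Fin (n + 2) → ℝ)))
    have hw : w ∈ (r.domain \ Cl) \ Ce := hw
    rcases hw with ⟨⟨hwr, hwl⟩, hwe⟩
    rw [hrd] at hwr
    rcases hwr with ⟨hxτ, -⟩
    have h1 : ¬ g (fun i : Fin n => w (Fin.castAdd 2 i)) < 0 := fun h' => hwl ⟨hxτ, h'⟩
    have h2 : ¬ g (fun i : Fin n => w (Fin.castAdd 2 i)) = 0 := fun h' => hwe ⟨hxτ, h'⟩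
    have h3 := (hreg _ hxτ).2
    simp only [hg_def, hρ2_def] at h1 h2 h3
    exact (lt_irrefl (1 : ℝ)) (by
      rcases lt_trichotomy (α₁ (fun i : Fin n => w (Fin.castAdd 2 i)) ^ 2 +
        α₂ (fun i : Fin n => w (Fin.castAdd 2 i)) ^ 2 - 1) 0 with hlt | heq | hgt
      · exact absurd hlt h1
      · exact absurd heq h2
      · linarith)
  -- piece `|α| < 1`: rotate, then Jensen inside
  have hdl : rl.domain = {w | (fun i : Fin n => w (Fin.castAdd 2 i)) ∈ Tl ∧ ((1 < w (Fin.natAdd n 1) ∧ w (Fin.natAdd n 1) < (((1 - w (Fin.natAdd n 0) ^ 2) / (1 + w (Fin.natAdd n 0) ^ 2) - α₁ (fun i : Fin n => w (Fin.castAdd 2 i))) ^ 2 + (2 * w (Fin.natAdd n 0) / (1 + w (Fin.natAdd n 0) ^ 2) - α₂ (fun i : Fin n => w (Fin.castAdd 2 i))) ^ 2)) ∨ ((((1 - w (Fin.natAdd n 0) ^ 2) / (1 + w (Fin.natAdd n 0) ^ 2) - α₁ (fun i : Fin n => w (Fin.castAdd 2 i))) ^ 2 + (2 * w (Fin.natAdd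 n 0) / (1 + w (Fin.natAdd n 0) ^ 2) - α₂ (fun i : Fin n => w (Fin.castAdd 2 i))) ^ 2) < w (Fin.natAdd n 1) ∧ w (Fin.natAdd n 1) < 1))} := by
    show r.domain ∩ Cl = _
    ext w
    rw [hrd]
    simp only [mem_inter_iff, mem_setOf_eq, hCl_def]
    constructor
    · rintro ⟨⟨-, hf⟩, hx⟩; exact ⟨hx, hf⟩
    · rintro ⟨hx, hf⟩; exact ⟨⟨hTlτ hx, hf⟩, hx⟩
  have hil : ∀ w ∈ rl.domain, rl.integrand w = (if 1 < w (Fin.natAdd n 1) then (1:ℝ) else -1) * h (fun i : Fin n => w (Fin.castAdd 2 i)) / ((1 + w (Fin.natAdd n 0) ^ 2) * w (Fin.natAdd n 1)) :=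
    fun w hw' => hri w hw'.1
  have e4 : of rl ∈ S := by
    obtain ⟨R', hR'd, hR'i, e⟩ := hrot n Tl h α₁ α₂ rl hTl (hh.mono hTlτ hTl) (hα₁.mono hTlτ hTl)
      (hα₂.mono hTlτ hTl) (fun x hx => hdiff x hx.1) (fun x hx => (hreg x hx.1).1.ne') hdl hil
    obtain ⟨hhi, hhlog⟩ := hw n Tl h α₁ α₂ hTl (hh.mono hTlτ hTl) (hα₁.mono hTlτ hTl)
      (hα₂.mono hTlτ hTl) (hint.mono_set hTlτ)
    have ein : of R' ∈ S :=
      jensen_inside hS (B := Tl) (h := h) (ρ := ρ) hTl (hh.mono hTlτ hTl)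
        (hρs hTlτ hTl) (fun x hx => hρ0 x hx.1) hρ_lt (fun x hx => hρd x hx.1) hhi hhlog R' hR'd
        (by rw [hR'i]; exact fun _ _ => rfl)
    have : of rl = (of rl - of R') + of R' := by abel
    rw [this]
    exact S.add_mem e ein
  -- piece `|α| = 1`: rotate, then Jensen on the circle
  have hde : re.domain = {w | (fun i : Fin n => w (Fin.castAdd 2 i)) ∈ Te ∧ ((1 < w (Fin.natAdd n 1) ∧ w (Fin.natAdd n 1) < (((1 - w (Fin.natAdd n 0) ^ 2) / (1 + w (Fin.natAdd n 0) ^ 2) - α₁ (fun i : Fin n => w (Fin.castAdd 2 i))) ^ 2 + (2 * w (Fin.natAdd n 0) / (1 + w (Fin.natAdd n 0) ^ 2) - α₂ (fun i : Fin n => w (Fin.castAdd 2 i))) ^ 2)) ∨ ((((1 - w (Fin.natAdd n 0) ^ 2) / (1 + w (Fin.natAdd n 0) ^ 2) - α₁ (fun i : Fin n => w (Fin.castAdd 2 i))) ^ 2 + (2 * w (Fin.natAdd n 0) / (1 + w (Fin.natAdd n 0) ^ 2) - α₂ (fun i : Fin n => w (Fin.castAdd 2 i))) ^ 2) < w (Fin.natAdd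 n 1) ∧ w (Fin.natAdd n 1) < 1))} := by
    show (r.domain \ Cl) ∩ Ce = _
    ext w
    rw [hrd]
    simp only [mem_inter_iff, mem_sdiff, mem_setOf_eq, hCl_def, hCe_def]
    constructor
    · rintro ⟨⟨⟨-, hf⟩, -⟩, hx⟩; exact ⟨hx, hf⟩
    · rintro ⟨hx, hf⟩
      refine ⟨⟨⟨hTeτ hx, hf⟩, fun hxl => ?_⟩, hx⟩
      have h1 := hxl.2; have h2 := hx.2
      rw [h2] at h1; exact lt_irrefl _ h1
  have hie : ∀ w ∈ re.domain, re.integrand w = (if 1 < w (Fin.natAdd n 1) then (1:ℝ) else -1) * h (fun i : Fin n => w (Fin.castAdd 2 i)) / ((1 + w (Fin.natAdd n 0) ^ 2) * w (Fin.natAdd n 1)) :=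
    fun w hw' => hri w hw'.1.1
  have e5 : of re ∈ S := by
    obtain ⟨R', hR'd, hR'i, e⟩ := hrot n Te h α₁ α₂ re hTe (hh.mono hTeτ hTe) (hα₁.mono hTeτ hTe)
      (hα₂.mono hTeτ hTe) (fun x hx => hdiff x hx.1) (fun x hx => (hreg x hx.1).1.ne') hde hie
    obtain ⟨hhi, -⟩ := hw n Te h α₁ α₂ hTe (hh.mono hTeτ hTe) (hα₁.mono hTeτ hTe)
      (hα₂.mono hTeτ hTe) (hint.mono_set hTeτ)
    have ein : of R' ∈ S :=
      jensen_circle hS (B := Te) (h := h) (ρ := ρ) hTe (hh.mono hTeτ hTe)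
        (hρs hTeτ hTe) hρ_eq (fun x hx => hρd x hx.1) hhi R' hR'd
        (by rw [hR'i]; exact fun _ _ => rfl)
    have : of re = (of re - of R') + of R' := by abel
    rw [this]
    exact S.add_mem e ein
  -- sum up
  have : of r = (of r - of rl - of r₁) + (of r₁ - of re - of r₂) + of r₂ + of rl + of re := by abel
  rw [this]
  exact S.add_mem (S.add_mem (S.add_mem (S.add_mem e1 e2) e3) e4) e5

/-- **The `log⁺` representation in normal form.** [Kontsevich–Zagier 2001, §1.1]
[folklore] -/
theorem rprime_normal_form {S : AddSubgroup Literature.NumberTheory.Transcendental.KZ.FormalRep} (hS : Literature.NumberTheory.Transcendental.KZ.domainAddRel ∪ Literature.NumberTheory.Transcendental.KZ.integrandAddRel ∪ Literature.NumberTheory.Transcendental.KZ.changeOfVariablesRel ⊆ S) : ∀ (n : ℕ) (B : Set (Fin n → ℝ)) (h α₁ α₂ : (Fin n → ℝ) → ℝ) (r' : Literature.NumberTheory.Transcendental.KZ.IntegralRep (n + 2)), Literature.ModelTheory.ExponentialFields.IsSemialgebraic ℚ B → Literature.NumberTheory.Transcendental.IsSemialgebraicFunOn ℚ B h → Literature.NumberTheory.Transcendental.IsSemialgebraicFunOn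 ℚ B α₁ → Literature.NumberTheory.Transcendental.IsSemialgebraicFunOn ℚ B α₂ → (∀ x ∈ B, 1 < α₁ x ^ 2 + α₂ x ^ 2) → MeasureTheory.IntegrableOn (fun x => h x * (1 + |Real.log (α₁ x ^ 2 + α₂ x ^ 2)|)) B → r'.domain = {w | (fun i : Fin n => w (Fin.castAdd 2 i)) ∈ B ∧ 1 < w (Fin.natAdd n 1) ∧ w (Fin.natAdd n 1) < α₁ (fun i : Fin n => w (Fin.castAdd 2 i)) ^ 2 + α₂ (fun i : Fin n => w (Fin.castAdd 2 i)) ^ 2} → (∀ w ∈ r'.domain, r'.integrand w = h (fun i : Fin n => w (Fin.castAdd 2 i)) / ((1 + w (Fin.natAdd n 0) ^ 2) * w (Fin.natAdd n 1))) → ∃ R'' : Literature.NumberTheory.Transcendental.KZ.IntegralRep (n + 1 + 1), R''.domain = Literature.NumberTheory.Transcendental.KZ.logUnfoldDomain {b : Fin (n + 1) → ℝ | Fin.init b ∈ B} (fun b => Real.sqrt (α₁ (Fin.init b) ^ 2 + α₂ (Fin.init b) ^ 2) ^ 2) ∧ R''.integrand = Literature.NumberTheory.Transcendental.KZ.logUnfoldIntegrand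 (fun b => h (Fin.init b) / (1 + b (Fin.last n) ^ 2)) ∧ Literature.NumberTheory.Transcendental.KZ.of r' - Literature.NumberTheory.Transcendental.KZ.of R'' ∈ S := by
  intro n B h α₁ α₂ r' hB hh hα₁ hα₂ hreg hint hr'd hr'i
  have hBm : MeasurableSet B := IsSemialgebraic.measurableSet_holds hB
  set T : Set (Fin (n + 1) → ℝ) := {b | Fin.init b ∈ B} with hT_def
  have hT : IsSemialgebraic ℚ T := isSemialgebraic_cyl hB
  set G : (Fin (n + 1) → ℝ) → ℝ := fun b => h (Fin.init b) / (1 + b (Fin.last n) ^ 2) with hG_def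
  have hGT : IsSemialgebraicFunOn ℚ T G := isSemialgebraicFunOn_weight hh hT subset_rfl
  set ρ : (Fin n → ℝ) → ℝ := fun x => Real.sqrt (α₁ x ^ 2 + α₂ x ^ 2) with hρ_def
  have hρs : IsSemialgebraicFunOn ℚ B ρ := isSemialgebraicFunOn_modulus hα₁ hα₂
  set V : (Fin (n + 1) → ℝ) → ℝ := fun b => Real.sqrt (α₁ (Fin.init b) ^ 2 + α₂ (Fin.init b) ^ 2) ^ 2
    with hV_def
  have h0 : ∀ x, 0 ≤ α₁ x ^ 2 + α₂ x ^ 2 := fun x => by positivity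
  have hVρ2 : ∀ b, V b = α₁ (Fin.init b) ^ 2 + α₂ (Fin.init b) ^ 2 := fun b => by
    simp only [hV_def]; exact Real.sq_sqrt (h0 _)
  have hVT : IsSemialgebraicFunOn ℚ T V :=
    ((IsSemialgebraicFunOn.mul_holds hρs hρs).comp_init.mono subset_rfl hT).congr fun b _ => by
      simp [hV_def, hρ_def, sq]
  have hV0 : ∀ b ∈ T, 0 ≤ V b := fun b _ => by simp only [hV_def]; positivity
  have hV1 : ∀ b ∈ T, 1 < V b := fun b hb => by rw [hVρ2]; exact hreg _ hb
  have hZ : volume {b | b ∈ T ∧ V b = 0} = 0 := by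
    rw [show {b | b ∈ T ∧ V b = 0} = (∅ : Set (Fin (n + 1) → ℝ)) by
      ext b; simp only [mem_setOf_eq, mem_empty_iff_false, iff_false, not_and]
      exact fun hb hV => by have := hV1 b hb; rw [hV] at this; exact absurd this (by norm_num)]
    exact measure_empty
  -- integrability of `G · log V` on `T` from the weight hypothesis (bounded multiplier, then cylinder)
  have hlogB : IntegrableOn (fun x => h x * Real.log (α₁ x ^ 2 + α₂ x ^ 2)) B := by
    set W : (Fin n → ℝ) → ℝ := B.indicator (fun x => α₁ x ^ 2 + α₂ x ^ 2) with hW_def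
    have hρ2 : IsSemialgebraicFunOn ℚ B (fun x => α₁ x ^ 2 + α₂ x ^ 2) :=
      (IsSemialgebraicFunOn.add_holds (IsSemialgebraicFunOn.mul_holds hα₁ hα₁)
        (IsSemialgebraicFunOn.mul_holds hα₂ hα₂)).congr fun x _ => by
        simp only [Pi.add_apply, Pi.mul_apply]; ring
    have hWm : Measurable W := hρ2.measurable_indicator_of_tarskiSeidenberg tarski_seidenberg_real_holds hBm
    have hWB : ∀ x ∈ B, W x = α₁ x ^ 2 + α₂ x ^ 2 := fun x hx => by simp [hW_def, indicator_of_mem hx]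
    have hL : Measurable fun x => Real.log (W x) := Real.measurable_log.comp hWm
    set m : (Fin n → ℝ) → ℝ := fun x => Real.log (W x) * (1 + |Real.log (W x)|)⁻¹ with hm_def
    have hm : Measurable m := hL.mul (measurable_const.add hL.abs).inv
    have hpos : ∀ x, 0 < 1 + |Real.log (W x)| := fun x => by positivity
    have hb : ∀ x, |m x| ≤ 1 := fun x => by
      have ha := abs_nonneg (Real.log (W x))
      show |Real.log (W x) * (1 + |Real.log (W x)|)⁻¹| ≤ 1
      rw [abs_mul, abs_inv, abs_of_pos (hpos x), ← div_eq_mul_inv, div_le_one (hpos x)]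
      linarith
    refine (integrableOn_measurable_bdd_mul hint hm hb).congr_fun (fun x hx => ?_) hBm
    have hne : (1 + |Real.log (α₁ x ^ 2 + α₂ x ^ 2)| : ℝ) ≠ 0 := by positivity
    simp only [hm_def, hWB x hx]
    field_simp
  have hGlogV : IntegrableOn (fun b => G b * Real.log (V b)) T := by
    have := integrableOn_cyl_mul (B := B) (f := fun x => h x * Real.log (α₁ x ^ 2 + α₂ x ^ 2))
      (g := fun s : ℝ => (1 + s ^ 2)⁻¹) hlogB integrable_inv_one_add_sq
    refine this.congr_fun (fun b _ => ?_) (IsSemialgebraic.measurableSet_holds hT)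
    simp only [hG_def, hVρ2]
    ring
  set R'' : IntegralRep (n + 1 + 1) := logUnfoldRep T V G hT hGT hVT hV0 hZ hGlogV with hR''
  refine ⟨R'', rfl, rfl, ?_⟩
  -- `r′` and `R″` have the same domain and integrands agreeing on it
  have hdom : R''.domain = r'.domain := by
    rw [hr'd]
    show logUnfoldDomain T V = _
    ext w
    simp only [logUnfoldDomain, mem_setOf_eq, hT_def]
    constructor
    · rintro ⟨hb, h1 | h2⟩
      · refine ⟨hb, h1.1, ?_⟩
        have := h1.2; rw [hVρ2] at this; exact this
      · exfalso; have := hV1 _ hb; linarith [h2.1, h2.2]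
    · rintro ⟨hb, hu1, hu2⟩
      refine ⟨hb, Or.inl ⟨hu1, ?_⟩⟩
      rw [hVρ2]; exact hu2
  refine of_sub_of_mem_of_eqOn hS hdom (fun w hw => ?_)
  rw [hr'i w hw]
  rw [hr'd] at hw
  have hu : 1 < w (Fin.natAdd n 1) := hw.2.1
  show h (fun i : Fin n => w (Fin.castAdd 2 i)) / ((1 + w (Fin.natAdd n 0) ^ 2) * w (Fin.natAdd n 1)) =
    (if 1 < w (Fin.natAdd n 1) then (1:ℝ) else -1) *
      (h (fun i : Fin n => w (Fin.castAdd 2 i)) / (1 + w (Fin.natAdd n 0) ^ 2)) / w (Fin.natAdd n 1)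
  rw [if_pos hu, one_mul, div_div]

/-- **Jensen outside the closed disc, smooth centre** (the statement of route item
`K2SymbolChains.JensenMoveOutside`, spelled out). [Jensen 1899; Kontsevich–Zagier 2001, §1.2] [folklore] -/
theorem jensenMoveOutside_mem {S : AddSubgroup Literature.NumberTheory.Transcendental.KZ.FormalRep} (hS : Literature.NumberTheory.Transcendental.KZ.domainAddRel ∪ Literature.NumberTheory.Transcendental.KZ.integrandAddRel ∪ Literature.NumberTheory.Transcendental.KZ.changeOfVariablesRel ⊆ S) :
    ∀ (n : ℕ) (τ : Set (Fin n → ℝ)) (h α₁ α₂ : (Fin n → ℝ) → ℝ) (r r' : Literature.NumberTheory.Transcendental.KZ.IntegralRep (n + 2)), Literature.ModelTheory.ExponentialFields.IsSemialgebraic ℚ τ → Literature.NumberTheory.Transcendental.IsSemialgebraicFunOn ℚ τ h → Literature.NumberTheory.Transcendental.IsSemialgebraicFunOn ℚ τ α₁ → Literature.NumberTheory.Transcendental.IsSemialgebraicFunOn ℚ τ α₂ → (∀ x ∈ τ, DifferentiableAt ℝ α₁ x ∧ DifferentiableAt ℝ α₂ x) → (∀ x ∈ τ, 1 < α₁ x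 ^ 2 + α₂ x ^ 2) → MeasureTheory.IntegrableOn (fun x => h x * (1 + |Real.log (α₁ x ^ 2 + α₂ x ^ 2)|)) τ → r.domain = {w | (fun i : Fin n => w (Fin.castAdd 2 i)) ∈ τ ∧ ((1 < w (Fin.natAdd n 1) ∧ w (Fin.natAdd n 1) < (((1 - w (Fin.natAdd n 0) ^ 2) / (1 + w (Fin.natAdd n 0) ^ 2) - α₁ (fun i : Fin n => w (Fin.castAdd 2 i))) ^ 2 + (2 * w (Fin.natAdd n 0) / (1 + w (Fin.natAdd n 0) ^ 2) - α₂ (fun i : Fin n => w (Fin.castAdd 2 i))) ^ 2)) ∨ ((((1 - w (Fin.natAdd n 0) ^ 2) / (1 + w (Fin.natAdd n 0) ^ 2) - α₁ (fun i : Fin n => w (Fin.castAdd 2 i))) ^ 2 + (2 * w (Fin.natAdd n 0) / (1 + w (Fin.natAdd n 0) ^ 2) - α₂ (fun i : Fin n => w (Fin.castAdd 2 i))) ^ 2) < w (Fin.natAdd n 1) ∧ w (Fin.natAdd n 1) < 1))} → (∀ w ∈ r.domain, r.integrand w = (if 1 < w (Fin.natAdd n 1) then (1:ℝ) else -1) *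 h (fun i : Fin n => w (Fin.castAdd 2 i)) / ((1 + w (Fin.natAdd n 0) ^ 2) * w (Fin.natAdd n 1))) → r'.domain = {w | (fun i : Fin n => w (Fin.castAdd 2 i)) ∈ τ ∧ 1 < w (Fin.natAdd n 1) ∧ w (Fin.natAdd n 1) < α₁ (fun i : Fin n => w (Fin.castAdd 2 i)) ^ 2 + α₂ (fun i : Fin n => w (Fin.castAdd 2 i)) ^ 2} → (∀ w ∈ r'.domain, r'.integrand w = h (fun i : Fin n => w (Fin.castAdd 2 i)) / ((1 + w (Fin.natAdd n 0) ^ 2) * w (Fin.natAdd n 1))) → Literature.NumberTheory.Transcendental.KZ.of r - Literature.NumberTheory.Transcendental.KZ.of r' ∈ S := by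
  have hrot := rotate_normal_form hS
  have hw := @weights
  have hrp := rprime_normal_form hS
  intro n τ h α₁ α₂ r r' hτ hh hα₁ hα₂ hdiff hreg hint hrd hri hr'd hr'i
  have hne : ∀ x ∈ τ, α₁ x ^ 2 + α₂ x ^ 2 ≠ 0 := fun x hx => by have := hreg x hx; positivity
  obtain ⟨R', hR'd, hR'i, e1⟩ := hrot n τ h α₁ α₂ r hτ hh hα₁ hα₂ hdiff hne hrd hri
  obtain ⟨R'', hR''d, hR''i, e2⟩ := hrp n τ h α₁ α₂ r' hτ hh hα₁ hα₂ hreg hint hr'd hr'i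
  obtain ⟨hhi, hhlog⟩ := hw n τ h α₁ α₂ hτ hh hα₁ hα₂ hint
  set ρ : (Fin n → ℝ) → ℝ := fun x => Real.sqrt (α₁ x ^ 2 + α₂ x ^ 2) with hρ_def
  have hρs : IsSemialgebraicFunOn ℚ τ ρ := isSemialgebraicFunOn_modulus hα₁ hα₂
  have hρ1 : ∀ x ∈ τ, 1 < ρ x := fun x hx => by
    have := Real.sqrt_lt_sqrt zero_le_one (hreg x hx)
    simpa [hρ_def] using this
  have hρd : ∀ x ∈ τ, DifferentiableAt ℝ ρ x := fun x hx =>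
    differentiableAt_modulus (hdiff x hx).1 (hdiff x hx).2 (hne x hx)
  have e3 : of R' - of R'' ∈ S :=
    jensen_outside hS (B := τ) (h := h) (ρ := ρ) hτ hh hρs hρ1 hρd hhi hhlog R' R''
      hR'd (by rw [hR'i]; exact fun _ _ => rfl) hR''d (by rw [hR''i]; exact fun _ _ => rfl)
  have : of r - of r' = (of r - of R') + (of R' - of R'') - (of r' - of R'') := by abel
  rw [this]
  exact S.sub_mem (S.add_mem e1 e3) e2

/-- For a `ℚ`-semialgebraic `τ`, `interior τ` is `ℚ`-semialgebraic and `τ ∖ interior τ` is null.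
[BCR 1998, Prop. 2.2.2, §2.8] [folklore] -/
theorem interior_conull {n : ℕ} {τ : Set (Fin n → ℝ)} (hτ : IsSemialgebraic ℚ τ) :
    IsSemialgebraic ℚ (interior τ) ∧ volume (τ \ interior τ) = 0 := by
  have hU : IsSemialgebraic ℚ (interior τ) := isSemialgebraic_interior hτ
  refine ⟨hU, KZ.volume_eq_zero_of_interior_eq_empty (hτ.diff hU) ?_⟩
  apply Set.eq_empty_iff_forall_notMem.2
  intro x hx
  have h1 : x ∈ interior τ := interior_mono sdiff_subset hx
  have h2 : x ∈ τ \ interior τ := interior_subset hx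
  exact h2.2 h1

/-- **Generic differentiability of `ℚ`-semialgebraic functions** (the statement of route item
`K2SymbolChains.GenericDifferentiability`, spelled out). [BCR 1998, §2.9] [folklore] -/
theorem genericDifferentiability :
    ∀ (n : ℕ) (τ : Set (Fin n → ℝ)) (f : (Fin n → ℝ) → ℝ), Literature.ModelTheory.ExponentialFields.IsSemialgebraic ℚ τ → Literature.NumberTheory.Transcendental.IsSemialgebraicFunOn ℚ τ f → ∃ B : Set (Fin n → ℝ), B ⊆ τ ∧ Literature.ModelTheory.ExponentialFields.IsSemialgebraic ℚ B ∧ MeasureTheory.volume (τ \ B) = 0 ∧ ∀ x ∈ B, DifferentiableAt ℝ f x := by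
  intro n τ f hτ hf
  obtain ⟨hU, hU0⟩ := interior_conull hτ
  have hfU : IsSemialgebraicFunOn ℚ (interior τ) f := hf.mono interior_subset hU
  obtain ⟨Z, hZU, hZ, hZint, hopen, hC⟩ :=
    IsSemialgebraicFunOn.exists_contDiffOn_holds (k := ℚ) (s := interior τ) (f := f) isOpen_interior hfU
  have hZ0 : volume Z = 0 := KZ.volume_eq_zero_of_interior_eq_empty hZ hZint
  refine ⟨interior τ \ Z, fun x hx => interior_subset hx.1, hU.diff hZ, ?_, fun x hx => ?_⟩
  · refine measure_mono_null (fun x hx => ?_) (measure_union_null hU0 hZ0)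
    rcases hx with ⟨hxτ, hxB⟩
    by_cases hxU : x ∈ interior τ
    · right; by_contra hxZ; exact hxB ⟨hxU, hxZ⟩
    · left; exact ⟨hxτ, hxU⟩
  · exact ((hC.contDiffAt (hopen.mem_nhds hx)).differentiableAt (by simp))

/-- **JENSEN IS A MOVE** — the crux `K2SymbolChains.JensenMove` (stmt-KontsevichZagierPeriods-5199),
assembled from `jensenMoveDisc`, `jensenMoveOutside`, `genericDifferentiability`: intersect the smooth
loci of `α₁, α₂`, discard the null remainder of the base and the locus `α = 0` (empty fibre), cut
the rest into the regimes `0 < |α| ≤ 1` / `|α| > 1` (rule 1a), apply the two pieces, and note that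
`r′` lives over the exterior regime up to a null set. [Jensen 1899; Kontsevich–Zagier 2001, §1.2,
rules 1)–2)] [folklore] -/
theorem jensenMove_mem {S : AddSubgroup Literature.NumberTheory.Transcendental.KZ.FormalRep} (hS : Literature.NumberTheory.Transcendental.KZ.domainAddRel ∪ Literature.NumberTheory.Transcendental.KZ.integrandAddRel ∪ Literature.NumberTheory.Transcendental.KZ.changeOfVariablesRel ⊆ S) :
    ∀ (n : ℕ) (τ : Set (Fin n → ℝ)) (h α₁ α₂ : (Fin n → ℝ) → ℝ) (r r' : Literature.NumberTheory.Transcendental.KZ.IntegralRep (n + 2)), Literature.ModelTheory.ExponentialFields.IsSemialgebraic ℚ τ → Literature.NumberTheory.Transcendental.IsSemialgebraicFunOn ℚ τ h → Literature.NumberTheory.Transcendental.IsSemialgebraicFunOn ℚ τ α₁ → Literature.NumberTheory.Transcendental.IsSemialgebraicFunOn ℚ τ α₂ → MeasureTheory.IntegrableOn (fun x => h x * (1 + |Real.log (α₁ x ^ 2 + α₂ x ^ 2)|)) τ → r.domain = {w | (fun i : Fin n => w (Fin.castAdd 2 i)) ∈ τ ∧ ((1 < w (Fin.natAdd n 1)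 ∧ w (Fin.natAdd n 1) < (((1 - w (Fin.natAdd n 0) ^ 2) / (1 + w (Fin.natAdd n 0) ^ 2) - α₁ (fun i : Fin n => w (Fin.castAdd 2 i))) ^ 2 + (2 * w (Fin.natAdd n 0) / (1 + w (Fin.natAdd n 0) ^ 2) - α₂ (fun i : Fin n => w (Fin.castAdd 2 i))) ^ 2)) ∨ ((((1 - w (Fin.natAdd n 0) ^ 2) / (1 + w (Fin.natAdd n 0) ^ 2) - α₁ (fun i : Fin n => w (Fin.castAdd 2 i))) ^ 2 + (2 * w (Fin.natAdd n 0) / (1 + w (Fin.natAdd n 0) ^ 2) - α₂ (fun i : Fin n => w (Fin.castAdd 2 i))) ^ 2) < w (Fin.natAdd n 1) ∧ w (Fin.natAdd n 1) < 1))} → (∀ w ∈ r.domain, r.integrand w = (if 1 < w (Fin.natAdd n 1) then (1:ℝ) else -1) * h (fun i : Fin n => w (Fin.castAdd 2 i)) / ((1 + w (Fin.natAdd n 0) ^ 2) * w (Fin.natAdd n 1))) → r'.domain = {w | (fun i : Fin n => w (Fin.castAdd 2 i)) ∈ τ ∧ 1 < w (Fin.natAdd n 1) ∧ w (Fin.natAdd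 n 1) < α₁ (fun i : Fin n => w (Fin.castAdd 2 i)) ^ 2 + α₂ (fun i : Fin n => w (Fin.castAdd 2 i)) ^ 2} → (∀ w ∈ r'.domain, r'.integrand w = h (fun i : Fin n => w (Fin.castAdd 2 i)) / ((1 + w (Fin.natAdd n 0) ^ 2) * w (Fin.natAdd n 1))) → Literature.NumberTheory.Transcendental.KZ.of r - Literature.NumberTheory.Transcendental.KZ.of r' ∈ S := by
  have hDisc := jensenMoveDisc_mem hS
  have hOut := jensenMoveOutside_mem hS
  have hGen := genericDifferentiability
  intro n τ h α₁ α₂ r r' hτ hh hα₁ hα₂ hint hrd hri hr'd hr'i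
  -- Step 1: the common smooth locus `B` of `α₁`, `α₂`, of full measure in `τ`.
  obtain ⟨B₁, hB₁τ, hB₁, hB₁0, hd₁⟩ := hGen n τ α₁ hτ hα₁
  obtain ⟨B₂, hB₂τ, hB₂, hB₂0, hd₂⟩ := hGen n τ α₂ hτ hα₂
  set B : Set (Fin n → ℝ) := B₁ ∩ B₂ with hB_def
  have hB : IsSemialgebraic ℚ B := hB₁.inter hB₂
  have hBτ : B ⊆ τ := fun x hx => hB₁τ hx.1
  have hτB0 : volume (τ \ B) = 0 := by
    refine measure_mono_null (fun x hx => ?_) (measure_union_null hB₁0 hB₂0)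
    rcases hx with ⟨hxτ, hxB⟩
    by_cases h1 : x ∈ B₁
    · exact Or.inr ⟨hxτ, fun h2 => hxB ⟨h1, h2⟩⟩
    · exact Or.inl ⟨hxτ, h1⟩
  -- Step 2: the regimes `|α| > 1` (`Bo`) and `0 < |α| ≤ 1` (`Bd`) inside `B`.
  set ρ2 : (Fin n → ℝ) → ℝ := fun x => α₁ x ^ 2 + α₂ x ^ 2 with hρ2_def
  have hρ2 : IsSemialgebraicFunOn ℚ B ρ2 :=
    (IsSemialgebraicFunOn.add_holds (IsSemialgebraicFunOn.mul_holds (hα₁.mono hBτ hB) (hα₁.mono hBτ hB))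
      (IsSemialgebraicFunOn.mul_holds (hα₂.mono hBτ hB) (hα₂.mono hBτ hB))).congr fun x _ => by
      simp only [hρ2_def, Pi.add_apply, Pi.mul_apply]; ring
  set g : (Fin n → ℝ) → ℝ := fun x => 1 - ρ2 x with hg_def
  have hg : IsSemialgebraicFunOn ℚ B g :=
    (IsSemialgebraicFunOn.sub_holds (isSemialgebraicFunOn_ratCast hB 1) hρ2).congr fun x _ => by
      simp [hg_def]
  set Bo : Set (Fin n → ℝ) := {x | x ∈ B ∧ g x < 0} with hBo_def
  have hBo : IsSemialgebraic ℚ Bo := hg.isSemialgebraic_sep_neg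
  set Bc : Set (Fin n → ℝ) := {x | x ∈ B ∧ 0 ≤ g x} with hBc_def
  have hBc : IsSemialgebraic ℚ Bc := hg.isSemialgebraic_sep_nonneg
  have hBcB : Bc ⊆ B := fun x hx => hx.1
  set Bd : Set (Fin n → ℝ) := {x | x ∈ Bc ∧ ρ2 x ≠ 0} with hBd_def
  have hBd : IsSemialgebraic ℚ Bd := (hρ2.mono hBcB hBc).isSemialgebraic_sep_ne_zero
  have hBoB : Bo ⊆ B := fun x hx => hx.1
  have hBdB : Bd ⊆ B := fun x hx => hx.1.1
  have hBoτ : Bo ⊆ τ := hBoB.trans hBτ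
  have hBdτ : Bd ⊆ τ := hBdB.trans hBτ
  have hρ2_nonneg : ∀ x, 0 ≤ ρ2 x := fun x => by simp only [hρ2_def]; positivity
  have hBo_regime : ∀ x ∈ Bo, 1 < α₁ x ^ 2 + α₂ x ^ 2 := fun x hx => by
    have := hx.2; simp only [hg_def, hρ2_def] at this; linarith
  have hBd_regime : ∀ x ∈ Bd, 0 < α₁ x ^ 2 + α₂ x ^ 2 ∧ α₁ x ^ 2 + α₂ x ^ 2 ≤ 1 := fun x hx => by
    have h1 := hx.1.2; have h2 := hx.2
    simp only [hg_def, hρ2_def] at h1 h2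
    exact ⟨(hρ2_nonneg x).lt_of_ne (Ne.symm h2), by linarith⟩
  have hdiffB : ∀ x ∈ B, DifferentiableAt ℝ α₁ x ∧ DifferentiableAt ℝ α₂ x :=
    fun x hx => ⟨hd₁ x hx.1, hd₂ x hx.2⟩
  -- the trichotomy on the base: outside `Bd ∪ Bo`, a point of `τ` is off `B` or has `α = 0`
  have htrich : ∀ x ∈ τ, x ∉ Bd → x ∉ Bo → x ∉ B ∨ (α₁ x = 0 ∧ α₂ x = 0) := by
    intro x _ hxd hxo
    by_cases hxB : x ∈ B
    · right
      have hg0 : 0 ≤ g x := not_lt.1 fun hlt => hxo ⟨hxB, hlt⟩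
      have hρ0 : ρ2 x = 0 := by
        by_contra hne
        exact hxd ⟨⟨hxB, hg0⟩, hne⟩
      simp only [hρ2_def] at hρ0
      have h1 : α₁ x ^ 2 = 0 := by nlinarith [sq_nonneg (α₁ x), sq_nonneg (α₂ x)]
      have h2 : α₂ x ^ 2 = 0 := by nlinarith [sq_nonneg (α₁ x), sq_nonneg (α₂ x)]
      exact ⟨pow_eq_zero_iff (n := 2) (by norm_num) |>.1 h1, pow_eq_zero_iff (n := 2) (by norm_num) |>.1 h2⟩
    · exact Or.inl hxB
  -- Step 3: cut `r` along the cylinders over `Bd` and `Bo`.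
  set Cd : Set (Fin (n + 2) → ℝ) := {w | (fun i : Fin n => w (Fin.castAdd 2 i)) ∈ Bd} with hCd_def
  set Co : Set (Fin (n + 2) → ℝ) := {w | (fun i : Fin n => w (Fin.castAdd 2 i)) ∈ Bo} with hCo_def
  have hCd : IsSemialgebraic ℚ Cd := isSemialgebraic_cyl2 hBd
  have hCo : IsSemialgebraic ℚ Co := isSemialgebraic_cyl2 hBo
  set rd := r.restrict (r.domain ∩ Cd) (r.isSemialgebraic_domain.inter hCd) inter_subset_left
    with hrd_def
  set r₁ := r.restrict (r.domain \ Cd) (r.isSemialgebraic_domain.diff hCd) sdiff_subset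
    with hr₁_def
  have e1 : of r - of rd - of r₁ ∈ S :=
    of_sub_restrict_inter_sub_restrict_diff_mem hS r hCd
  set ro := r₁.restrict (r₁.domain ∩ Co) (r₁.isSemialgebraic_domain.inter hCo) inter_subset_left
    with hro_def
  set r₂ := r₁.restrict (r₁.domain \ Co) (r₁.isSemialgebraic_domain.diff hCo) sdiff_subset
    with hr₂_def
  have e2 : of r₁ - of ro - of r₂ ∈ S :=
    of_sub_restrict_inter_sub_restrict_diff_mem hS r₁ hCo
  -- Step 4: the remainder `r₂` lives over `(τ ∖ B) ∪ {α = 0}`; over `{α = 0}` its fibre is empty.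
  have e3 : of r₂ ∈ S := by
    refine of_mem_of_volume_eq_zero hS r₂ (measure_mono_null (fun w hw => ?_) (volume_cyl2_eq_zero hτB0))
    have hw : w ∈ (r.domain \ Cd) \ Co := hw
    rcases hw with ⟨⟨hwr, hwd⟩, hwo⟩
    rw [hrd] at hwr
    rcases hwr with ⟨hxτ, hfib⟩
    rcases htrich _ hxτ hwd hwo with hxB | ⟨h10, h20⟩
    · exact ⟨hxτ, hxB⟩
    · exfalso
      rw [h10, h20, ratCircle_normSq] at hfib
      rcases hfib with ⟨h1, h2⟩ | ⟨h1, h2⟩ <;> linarith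
  -- Step 5: piece 1 on the punctured-disc regime.
  have e4 : of rd ∈ S := by
    refine hDisc n Bd h α₁ α₂ rd hBd (hh.mono hBdτ hBd) (hα₁.mono hBdτ hBd) (hα₂.mono hBdτ hBd)
      (fun x hx => hdiffB x (hBdB hx)) hBd_regime (hint.mono_set hBdτ) ?_ ?_
    · show r.domain ∩ Cd = _
      ext w
      rw [hrd]
      simp only [mem_inter_iff, mem_setOf_eq, hCd_def]
      constructor
      · rintro ⟨⟨-, hf⟩, hx⟩; exact ⟨hx, hf⟩
      · rintro ⟨hx, hf⟩; exact ⟨⟨hBdτ hx, hf⟩, hx⟩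
    · intro w hw
      exact hri w hw.1
  -- Step 6: piece 2 on the exterior regime, with the matching piece of `r′`.
  set r'o := r'.restrict (r'.domain ∩ Co) (r'.isSemialgebraic_domain.inter hCo) inter_subset_left
    with hr'o_def
  have e5 : of ro - of r'o ∈ S := by
    refine hOut n Bo h α₁ α₂ ro r'o hBo (hh.mono hBoτ hBo) (hα₁.mono hBoτ hBo) (hα₂.mono hBoτ hBo)
      (fun x hx => hdiffB x (hBoB hx)) hBo_regime (hint.mono_set hBoτ) ?_ ?_ ?_ ?_
    · show (r.domain \ Cd) ∩ Co = _
      ext w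
      rw [hrd]
      simp only [mem_inter_iff, mem_sdiff, mem_setOf_eq, hCd_def, hCo_def]
      constructor
      · rintro ⟨⟨⟨-, hf⟩, -⟩, hx⟩; exact ⟨hx, hf⟩
      · rintro ⟨hx, hf⟩
        refine ⟨⟨⟨hBoτ hx, hf⟩, fun hxd => ?_⟩, hx⟩
        have h1 := hxd.1.2; have h2 := hx.2
        exact absurd h2 (not_lt.2 h1)
    · intro w hw
      exact hri w hw.1.1
    · show r'.domain ∩ Co = _
      ext w
      rw [hr'd]
      simp only [mem_inter_iff, mem_setOf_eq, hCo_def]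
      constructor
      · rintro ⟨⟨-, hf⟩, hx⟩; exact ⟨hx, hf⟩
      · rintro ⟨hx, hf⟩; exact ⟨⟨hBoτ hx, hf⟩, hx⟩
    · intro w hw
      exact hr'i w hw.1
  -- Step 7: `r′` minus its exterior piece lives over `τ ∖ B` (its fibres over `|α| ≤ 1` are empty).
  have e6 : of r' - of r'o ∈ S := by
    refine of_sub_of_mem_of_subset hS inter_subset_left
      (measure_mono_null (fun w hw => ?_) (volume_cyl2_eq_zero hτB0)) (fun _ _ => rfl)
    have hw : w ∈ r'.domain \ (r'.domain ∩ Co) := hw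
    rcases hw with ⟨hwr, hwo⟩
    have hwo' : w ∉ Co := fun h' => hwo ⟨hwr, h'⟩
    rw [hr'd] at hwr
    rcases hwr with ⟨hxτ, h1, h2⟩
    refine ⟨hxτ, fun hxB => hwo' ⟨hxB, ?_⟩⟩
    show g _ < 0
    simp only [hg_def, hρ2_def]
    linarith
  -- Step 8: sum up.
  have : of r - of r' = (of r - of rd - of r₁) + (of r₁ - of ro - of r₂) + of r₂ + of rd +
      (of ro - of r'o) - (of r' - of r'o) := by abel
  rw [this]
  exact S.sub_mem (S.add_mem (S.add_mem (S.add_mem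
    (S.add_mem e1 e2) e3) e4) e5) e6

/-- **JENSEN IS A MOVE** — the crux `K2SymbolChains.JensenMove` (stmt-KontsevichZagierPeriods-5199):
the case `S = KZ.relations`. [Jensen 1899; Kontsevich–Zagier 2001, §1.2, rules 1)–2)] [folklore] -/
theorem jensenMove :
    Summit.KontsevichZagierPeriods.KontsevichZagierPeriods.Theses.K2SymbolChains.JensenMove :=
  jensenMove_mem scissors_subset_relations

/-- **JENSEN IS SCISSORS** — the support item `K2SymbolChains.JensenIsScissors`
(stmt-KontsevichZagierPeriods-5204): the whole chain lies in the Newton–Leibniz-free sub-calculus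
`closure (1a ∪ 1b ∪ 2)` (the case `S` = that closure). [Jensen 1899; Kontsevich–Zagier 2001, §1.2,
rules 1)–2)] [folklore] -/
theorem jensenIsScissors :
    Summit.KontsevichZagierPeriods.KontsevichZagierPeriods.Theses.K2SymbolChains.JensenIsScissors :=
  jensenMove_mem AddSubgroup.subset_closure

/-! ### The split children and the glue as route items (route file rev ≥ 3) -/

/-- Route item `K2SymbolChains.JensenMoveDisc` (stmt-KontsevichZagierPeriods-17759). [Jensen 1899;
Kontsevich–Zagier 2001, §1.2] [folklore] -/
theorem jensenMoveDisc_item :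
    Summit.KontsevichZagierPeriods.KontsevichZagierPeriods.Theses.K2SymbolChains.JensenMoveDisc :=
  jensenMoveDisc_mem scissors_subset_relations

/-- Route item `K2SymbolChains.JensenMoveOutside` (stmt-KontsevichZagierPeriods-17758). [Jensen 1899;
Kontsevich–Zagier 2001, §1.2] [folklore] -/
theorem jensenMoveOutside_item :
    Summit.KontsevichZagierPeriods.KontsevichZagierPeriods.Theses.K2SymbolChains.JensenMoveOutside :=
  jensenMoveOutside_mem scissors_subset_relations

/-- Route item `K2SymbolChains.GenericDifferentiability` (stmt-KontsevichZagierPeriods-17757).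
[Bochnak–Coste–Roy 1998, §2.9] [folklore] -/
theorem genericDifferentiability_item :
    Summit.KontsevichZagierPeriods.KontsevichZagierPeriods.Theses.K2SymbolChains.GenericDifferentiability :=
  genericDifferentiability

/-- Route item `K2SymbolChains.JensenMoveGlue` (stmt-KontsevichZagierPeriods-17791): the glue of the
split, now a corollary of the parent. [folklore] -/
theorem jensenMoveGlue_item :
    Summit.KontsevichZagierPeriods.KontsevichZagierPeriods.Theses.K2SymbolChains.JensenMoveGlue :=
  fun _ _ _ => jensenMove

end Summit.KontsevichZagierPeriods.K2SymbolChains.JensenMoveProof
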